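import Literature.Analysis.FluidPDE.SereginSverakAxisymmetricProofs
import Literature.Analysis.FluidPDE.SereginSverakBlowupSelection
import HarnessLib

/-!
# Seregin–Šverák 2009, proof of Proposition 3.7: the inverse scaling, proved

Second sibling of `SereginSverakAxisymmetric.lean` (G. Seregin, V. Šverák, *On Type I
singularities of the local axi-symmetric solutions of the Navier–Stokes equations*, Comm. PDE 34
(2009) 171–201 = arXiv:0804.1803; page references are to the arXiv version). The companion file
`SereginSverakAxisymmetricProofs.lean` vendors the display after (as15) of the proof of Prop. 3.7
(arXiv p. 10) as the named fact `SereginSverak2009.OffAxisBound` and proves Prop. 3.7 from it and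
Lemma 3.5. The printed proof obtains that display in two steps:

> Now, let us scale our functions so that `x = r₀y + b₀e₃`, `t = r₀²s`, `u(y,s) = r₀v(x,t)`,
> `p(y,s) = r₀²q(x,t)`. As it was shown in [S11], there exists a continuous nondecreasing function
> `Φ : ℝ₊ → ℝ₊` such that
> `sup_{(y,s) ∈ Q¹₁(0)} |u(y,s)| + |∇u(y,s)| ≤ Φ( sup_{-2²<s<0} ∫_{𝒫²₁(0)} |u(y,s)|² dy
>   + ∫_{Q²₁(0)} |∇u|² dy ds + ∫_{Q²₁(0)} |u|³ dy ds + ∫_{Q²₁(0)} |p|^{3/2} dy ds )`.   (as15)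
> After making inverse scaling in (as15), we find
> `sup_{z ∈ Q¹_{r₀}(b₀)} r₀|v(x,t)| + r₀²|∇v(x,t)| ≤ Φ(cA(z_{b₀},3r₀;v) + cE(z_{b₀},3r₀;v)
>   + cC(z_{b₀},3r₀;v) + cD(z_{b₀},3r₀;q))`

(`𝒫¹_{r₀} = {r₀ < |x'| < 2r₀, |x₃| < r₀}`, `𝒫²_{r₀} = {r₀/4 < |x'| < 3r₀, |x₃| < 2r₀}`,
`Q¹_{r₀}(b₀) = (𝒫¹_{r₀} + b₀e₃) × ]-r₀², 0[`, `Q²_{r₀}(b₀) = (𝒫²_{r₀} + b₀e₃) × ]-(2r₀)², 0[`;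
the arXiv source prints the second term inside `Φ` in (as15) as `∫_{Q²₁(0)} |u|²`, a misprint for
`|∇u|²`: the scaled-back display carries `cE`, and the quantity is `𝒜₂` of [S11]). Here [S11] is
G. Seregin, W. Zajaczkowski, SIAM J. Math. Anal. 39 (2007) 669–685 = arXiv:math/0702720, whose
Prop. 4.1 (arXiv p. 5) reads: *Let `V` and `P` be a sufficiently smooth axially symmetric solution
to the Navier–Stokes equations in `Q̃ = 𝒞̃ × ]-2², 0[`, `𝒞̃ = 𝒞(1/4, 3; 2)`
(`𝒞(R₁, R₂; a) = {R₁ < |x'| < R₂, |x₃| < a}`). Then there exists a non-decreasing function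
`Φ : ℝ₊ → ℝ₊` such that `sup_{z ∈ 𝒞(1,2;1) × ]-1,0[} (|V(z)| + |∇V(z)|) ≤ Φ(𝒜₂)`,
`𝒜₂ = sup_{-2²<t<0} ∫_{𝒞̃} |V|² dx + ∫_{Q̃} (|∇V|² + |V|³ + |P|^{3/2}) dz`* — so `Q̃ = Q²₁(0)`,
`𝒞(1,2;1) × ]-1,0[ = Q¹₁(0)`, and (as15) is (4.1) for the rescaled pair; [S11], §5 (arXiv p. 8)
performs the identical inverse scaling `u^R(x,t) = R u(Rx + be₃, R²t)`,
`Ã_{2R} ≤ c(A(e^b,3R;u) + E(e^b,3R;u) + C(e^b,3R;u) + D(e^b,3R;q))`.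

This file splits `OffAxisBound` along exactly these two steps:

* the first step is vendored as the named fact `SereginSverak2009.UnitScaleOffAxisBound` — (as15)
  for the class of pairs the paper applies it to, written at unit scale: Type I axially symmetric
  distributional solutions `(u, p)`, `u ∈ L³`, `p ∈ L^{3/2}`, on the cylinder
  `Q(0, 3) = 𝒞(0,3) × ]-9, 0[ ⊇ Q²₁(0)` (the image of `Q(z_{b₀}, 3r₀)` under the scaling; the
  structure `SereginSverak2009.IsTypeIAxisymmetricSolutionOn 3`), with `𝒜₂` the functional
  `SereginSverak2009.szEnergy` over the shells `Q²₁(0) ⊇ Q¹₁(0)`;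
* the second step ("After making inverse scaling in (as15), we find …") is PROVED:
  `SereginSverak2009.offAxisBound_of_unitScaleOffAxisBound : UnitScaleOffAxisBound → OffAxisBound`.
  Given `(v, q)` under the conditions of Thm. 3.1 on `Q`, `0 < r₀ < 1/8`, `|b₀| < 1/8`, the
  rescaled pair `u = r₀ v ∘ Φ`, `p = r₀² q ∘ Φ`, `Φ(s, y) = (r₀² s, b₀e₃ + r₀ y)`, is a Type I
  axially symmetric distributional solution on `Q(0,3) = Φ⁻¹(Q(z_{b₀}, 3r₀))`
  (`IsTypeIAxisymmetricSolutionOn.rescale`, from the accepted covariance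
  `IsDistributionalNSSolutionOn.stRescale` and `Q(z_{b₀}, 3r₀) ⊆ Q`); its weak spatial gradient is
  `r₀² G ∘ Φ` (`HasWeakSpatialGradientOn.stRescale`); the scale-invariant functionals agree,
  `(A, E, C, D)(0, 3; u, p) = (A, E, C, D)(z_{b₀}, 3r₀; v, q)` (`energyA_rescale_le`,
  `dissipationE_rescale`, `cubicC_rescale`, `pressureD_rescale` — change of variables
  `dz = r₀⁵ dz'`); `𝒜₂(u, p) ≤ 9 (A + E + C + D)(0, 3; u, p)` since `Q²₁(0) ⊆ Q(0,3)`
  (`szEnergy_le`, the constant `c` of the display); and `Φ` maps `Q¹₁(0)` onto `Q¹_{r₀}(b₀)`, so the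
  a.e. bound `|u| ≤ Φ(9K)` on `Q¹₁(0)` is the a.e. bound `r₀|v| ≤ Φ(9K)` on `Q¹_{r₀}(b₀)`. The
  `Φ` of `OffAxisBound` is `K ↦ Φ(9K)` ("`c` absorbed into `Φ`", as documented there).

Consequently `OffAxisBound_holds`, and with `ScaledEnergyBound_holds` also `AxisDecayBound_holds`
(Prop. 3.7), reduce to `UnitScaleOffAxisBound_holds`, i.e. to Seregin–Zajaczkowski 2007,
Prop. 4.1 for this class of solutions. That discharge is NOT attempted here: the printed proof
of Prop. 4.1 (SZ2007 §4: Lemmas 4.2–4.3, Cor. 4.4, concluded by their Lemma 2.3, an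
`L₆`-boundedness criterion for suitable weak solutions from the Caffarelli–Kohn–Nirenberg
ε-regularity theory) and the regularity of Type I (hence locally bounded, (r3) ⇒ (r2), Remark 3.4)
axially symmetric distributional solutions needed to apply it to this class are far beyond
Mathlib and the tree.

## Rendering choices for `UnitScaleOffAxisBound` (all weaker than or equal to the print)

* The class: the paper asserts (as15) for the rescalings of pairs satisfying the conditions of
  Thm. 3.1, which are Type I axially symmetric distributional solutions with `u ∈ L³`,
  `p ∈ L^{3/2}` on `Φ⁻¹(Q) ⊇ Q(0,3)`; both (as15) and [S11, Prop. 4.1] only involve the pair on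
  `Q²₁(0) ⊆ Q(0,3)`, and `Q(0,3)` is the cylinder whose functionals the next display uses. The
  hypotheses are those of `IsAxisymmetricLocalSolution ∧ IsTypeIOnCyl` transported to `Q(0,3)`
  (`isTypeIAxisymmetricSolutionOn_one_iff`).
* As in `OffAxisBound`: SOME non-decreasing `Φ : ℝ≥0 → ℝ≥0` chosen before the solution
  (continuity dropped); the bound `‖u‖ ≤ Φ K` almost everywhere on `Q¹₁(0)` whenever `𝒜₂ ≤ K`
  (for non-decreasing `Φ` this is the printed `≤ Φ(𝒜₂)`, vacuous when `𝒜₂ = ∞`); the gradient half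
  `|∇u|` of the left-hand side is dropped; `sup` is rendered as an a.e. bound; `∫ |∇u|²` is computed
  through an arbitrary weak spatial gradient `G` of `u` on `Q(0,3)`.

## Contents

* `cylRadius_axisAffine`, `preimage_spaceCyl_axisAffine`, `preimage_parCyl_axisAffine`,
  `preimage_innerShell_axisAffine`, `parCyl_axis_subset_unit` — the geometry of
  `Φ(s, y) = (λ² s, b e₃ + λ y)` (the rotation lemmas `rotZ_smul_eZ_add_smul`,
  `isAxisymmetric_rescale` and `stAffine_preimage_parCyl` are the accepted ones of
  `SereginSverakBlowupSelection`);
* `outerShellSpace`, `outerShell` (`𝒫²_{r₀}(b₀)`, `Q²_{r₀}(b₀)`), `szEnergy` (`𝒜₂`),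
  `IsTypeIAxisymmetricSolutionOn`, the named fact `UnitScaleOffAxisBound`;
* `szEnergy_le`, `IsTypeIAxisymmetricSolutionOn.rescale`, `energyA_rescale_le`,
  `dissipationE_rescale`, `cubicC_rescale`, `pressureD_rescale`, the proved reduction
  `offAxisBound_of_unitScaleOffAxisBound`, and the corollary
  `axisDecayBound_of_unitScaleOffAxisBound` (Prop. 3.7 from Lemma 3.5 and (as15)).

## References

* G. Seregin, V. Šverák, Comm. PDE 34 (2009) 171–201, arXiv:0804.1803: proof of Prop. 3.7,
  (as15) and the display after it (arXiv p. 10); §3, p. 9 (functionals `A, E, C, D`, the scaling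
  `u(x,t) = λv(λx, λ²t)`, `p = λ²q`). [`SereginSverak2009`]
* G. Seregin, W. Zajaczkowski, SIAM J. Math. Anal. 39 (2007) 669–685, arXiv:math/0702720:
  Prop. 4.1, (4.1) and `𝒜₂` (arXiv p. 5); §5 (arXiv p. 8, the inverse scaling and
  `Ã_{2R} ≤ c(A + E + C + D)(e^b, 3R)`). [`SereginZajaczkowski2007`]
-/

noncomputable section

open MeasureTheory Set Function Filter Topology TopologicalSpace Module
open scoped NNReal ENNReal

namespace Literature.Analysis.FluidPDE

namespace SereginSverak2009

/-- Local notation for physical space `ℝ³ = EuclideanSpace ℝ (Fin 3)`. -/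
local notation "ℝ³" => EuclideanSpace ℝ (Fin 3)

/-! ### The geometry of `Φ(s, y) = (λ² s, b e₃ + λ y)` -/

/-- The third coordinate of `b e₃` is `b`. [folklore] -/
theorem smul_eZ_apply_two (b : ℝ) : (b • eZ : ℝ³) 2 = b := by
  simp [eZ]

/-- `|(b e₃ + λ y)'| = λ |y'|` for `λ ≥ 0`. [folklore] -/
theorem cylRadius_axisAffine {lam : ℝ} (hlam : 0 ≤ lam) (b : ℝ) (y : ℝ³) :
    cylRadius (b • eZ + lam • y) = lam * cylRadius y := by
  rw [← cylRadius_sub_smul_eZ (b • eZ + lam • y) b, add_sub_cancel_left, cylRadius_smul,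
    abs_of_nonneg hlam]

/-- The space map `y ↦ b e₃ + λ y` pulls `𝒞(b e₃, λρ)` back to `𝒞(0, ρ)` (`λ > 0`). [folklore] -/
theorem preimage_spaceCyl_axisAffine {lam : ℝ} (hlam : 0 < lam) (b ρ : ℝ) :
    (fun y : ℝ³ => b • eZ + lam • y) ⁻¹' spaceCyl (b • eZ) (lam * ρ) = spaceCyl 0 ρ := by
  ext y
  simp only [mem_preimage, mem_spaceCyl, add_sub_cancel_left, cylRadius_smul, abs_of_pos hlam,
    smul_eZ_add_smul_apply_two, smul_eZ_apply_two, add_sub_cancel_left, abs_mul,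
    sub_zero, PiLp.zero_apply]
  constructor
  · rintro ⟨h1, h2⟩
    exact ⟨lt_of_mul_lt_mul_left h1 hlam.le, lt_of_mul_lt_mul_left h2 hlam.le⟩
  · rintro ⟨h1, h2⟩
    exact ⟨mul_lt_mul_of_pos_left h1 hlam, mul_lt_mul_of_pos_left h2 hlam⟩

/-- `Φ(s, y) = (λ² s, b e₃ + λ y)` pulls `Q(z_b, λρ)`, `z_b = (b e₃, 0)`, back to `Q(0, ρ)`
(`λ > 0`): the scaling of the proof of Prop. 3.7 maps `Q(0,3)` onto `Q(z_{b₀}, 3r₀)`.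
[cite: SereginSverak2009, proof of Prop. 3.7 (arXiv p. 10)] -/
theorem preimage_parCyl_axisAffine {lam : ℝ} (hlam : 0 < lam) (b ρ : ℝ) :
    stAffine (lam ^ 2) lam 0 (b • eZ) ⁻¹' parCyl ((0 : ℝ), b • eZ) (lam * ρ) = parCyl 0 ρ := by
  rw [stAffine_preimage_parCyl hlam, mul_div_cancel_left₀ ρ hlam.ne']

/-- `Φ(s, y) = (λ² s, b e₃ + λ y)` pulls the shell `Q¹_{λρ}(b)` back to `Q¹_ρ(0)` (`λ > 0`): the
scaling of the proof of Prop. 3.7 maps `Q¹₁(0)` onto `Q¹_{r₀}(b₀)`.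
[cite: SereginSverak2009, proof of Prop. 3.7 (arXiv p. 10)] -/
theorem preimage_innerShell_axisAffine {lam : ℝ} (hlam : 0 < lam) (b ρ : ℝ) :
    stAffine (lam ^ 2) lam 0 (b • eZ) ⁻¹' innerShell (lam * ρ) b = innerShell ρ 0 := by
  have hl2 : 0 < lam ^ 2 := by positivity
  ext ⟨s, y⟩
  simp only [mem_preimage, stAffine_apply, mem_innerShell, mem_Ioo, zero_add,
    cylRadius_axisAffine hlam.le, smul_eZ_add_smul_apply_two, add_sub_cancel_left, abs_mul,
    abs_of_pos hlam, sub_zero]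
  constructor
  · rintro ⟨⟨h1, h2⟩, ⟨h3, h4⟩, h5⟩
    refine ⟨⟨?_, ?_⟩, ⟨lt_of_mul_lt_mul_left h3 hlam.le, ?_⟩, lt_of_mul_lt_mul_left h5 hlam.le⟩
    · by_contra hc
      push Not at hc
      nlinarith [mul_le_mul_of_nonneg_left hc hl2.le]
    · nlinarith
    · have h4' : lam * cylRadius y < lam * (2 * ρ) := by linarith
      exact lt_of_mul_lt_mul_left h4' hlam.le
  · rintro ⟨⟨h1, h2⟩, ⟨h3, h4⟩, h5⟩
    refine ⟨⟨?_, ?_⟩, ⟨mul_lt_mul_of_pos_left h3 hlam, ?_⟩, mul_lt_mul_of_pos_left h5 hlam⟩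
    · nlinarith [mul_lt_mul_of_pos_left h1 hl2]
    · nlinarith [mul_lt_mul_of_pos_left h2 hl2]
    · nlinarith [mul_lt_mul_of_pos_left h4 hlam]

/-- `Q(z_b, r) ⊆ Q = Q(0, 1)` as soon as `0 ≤ r ≤ 1` and `|b| + r ≤ 1` (`z_b = (b e₃, 0)`); in the
proof of Prop. 3.7, `Q(z_{b₀}, 3r₀) ⊆ Q` for `r₀ < 1/8`, `|b₀| < 1/8`.
[cite: SereginSverak2009, proof of Prop. 3.7 (arXiv p. 10)] -/
theorem parCyl_axis_subset_unit {r b : ℝ} (hr : 0 ≤ r) (hr1 : r ≤ 1) (hb : |b| + r ≤ 1) :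
    parCyl ((0 : ℝ), b • eZ) r ⊆ parCyl 0 1 := by
  intro z hz
  rw [mem_parCyl] at hz
  obtain ⟨⟨h1, h2⟩, h3, h4⟩ := hz
  simp only [zero_sub, smul_eZ_apply_two] at h1 h2 h4
  rw [cylRadius_sub_smul_eZ] at h3
  rw [mem_parCyl_zero]
  refine ⟨⟨by nlinarith, h2⟩, by linarith, ?_⟩
  calc |z.2 2| = |z.2 2 - b + b| := by rw [sub_add_cancel]
    _ ≤ |z.2 2 - b| + |b| := abs_add_le _ _
    _ < 1 := by linarith

/-! ### The shells `Q²_{r₀}(b₀)`, the functional `𝒜₂`, and (as15) as a named fact -/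

/-- The spatial shell `𝒫²_{r₀}(b₀) = {r₀/4 < |x'| < 3r₀, |x₃ - b₀| < 2r₀}` of the proof of
Seregin–Šverák 2009, Prop. 3.7 (arXiv p. 10); at `r₀ = 1`, `b₀ = 0` it is the shell
`𝒞̃ = 𝒞(1/4, 3; 2)` of Seregin–Zajaczkowski 2007, Prop. 4.1. Empty for `r₀ ≤ 0`.
[cite: SereginSverak2009, proof of Prop. 3.7 (arXiv p. 10)] -/
def outerShellSpace (r₀ b₀ : ℝ) : Set ℝ³ :=
  {x | cylRadius x ∈ Ioo (r₀ / 4) (3 * r₀) ∧ |x 2 - b₀| < 2 * r₀}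

/-- The space–time shell `Q²_{r₀}(b₀) = 𝒫²_{r₀}(b₀) × ]-(2r₀)², 0[` of the proof of Seregin–Šverák
2009, Prop. 3.7 (arXiv p. 10), time first; at `r₀ = 1`, `b₀ = 0` it is `Q̃ = 𝒞̃ × ]-2², 0[` of
Seregin–Zajaczkowski 2007, Prop. 4.1. [cite: SereginSverak2009, proof of Prop. 3.7 (arXiv p. 10)] -/
def outerShell (r₀ b₀ : ℝ) : Set (ℝ × ℝ³) :=
  {z | z.1 ∈ Ioo (-(2 * r₀) ^ 2) 0 ∧ z.2 ∈ outerShellSpace r₀ b₀}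

/-- Membership in `𝒫²_{r₀}(b₀)`, unfolded.
[cite: SereginSverak2009, proof of Prop. 3.7 (arXiv p. 10)] -/
theorem mem_outerShellSpace {r₀ b₀ : ℝ} {x : ℝ³} :
    x ∈ outerShellSpace r₀ b₀ ↔ cylRadius x ∈ Ioo (r₀ / 4) (3 * r₀) ∧ |x 2 - b₀| < 2 * r₀ :=
  Iff.rfl

/-- Membership in `Q²_{r₀}(b₀)`, unfolded.
[cite: SereginSverak2009, proof of Prop. 3.7 (arXiv p. 10)] -/
theorem mem_outerShell {r₀ b₀ : ℝ} {z : ℝ × ℝ³} :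
    z ∈ outerShell r₀ b₀ ↔ z.1 ∈ Ioo (-(2 * r₀) ^ 2) 0 ∧ z.2 ∈ outerShellSpace r₀ b₀ :=
  Iff.rfl

/-- `Q¹_{r₀}(b₀) ⊆ Q²_{r₀}(b₀)` for `r₀ ≥ 0`.
[cite: SereginSverak2009, proof of Prop. 3.7 (arXiv p. 10)] -/
theorem innerShell_subset_outerShell {r₀ : ℝ} (hr : 0 ≤ r₀) (b₀ : ℝ) :
    innerShell r₀ b₀ ⊆ outerShell r₀ b₀ := by
  intro z hz
  rw [mem_innerShell] at hz
  rw [mem_outerShell, mem_outerShellSpace]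
  exact ⟨⟨by nlinarith [hz.1.1], hz.1.2⟩, ⟨by linarith [hz.2.1.1], by linarith [hz.2.1.2]⟩,
    by linarith [hz.2.2]⟩

/-- `𝒫²₁(0) ⊆ 𝒞(0, 3)`. [folklore] -/
theorem outerShellSpace_one_subset : outerShellSpace 1 0 ⊆ spaceCyl (0 : ℝ³) 3 := by
  intro x hx
  rw [mem_outerShellSpace] at hx
  obtain ⟨⟨-, h1⟩, h2⟩ := hx
  rw [sub_zero] at h2
  rw [mem_spaceCyl, sub_zero]
  refine ⟨by linarith, ?_⟩
  have h3 : |x 2| < 3 := by linarith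
  simpa using h3

/-- `Q²₁(0) ⊆ Q(0, 3)`: the shell whose integrals form `𝒜₂` lies in the cylinder whose functionals
`A, E, C, D` appear after the inverse scaling.
[cite: SereginSverak2009, proof of Prop. 3.7 (arXiv p. 10)] -/
theorem outerShell_one_subset : outerShell 1 0 ⊆ parCyl (0 : ℝ × ℝ³) 3 := by
  intro z hz
  rw [mem_outerShell, mem_outerShellSpace] at hz
  obtain ⟨⟨h1, h2⟩, ⟨-, h3⟩, h4⟩ := hz
  rw [sub_zero] at h4
  rw [mem_parCyl_zero]
  exact ⟨⟨by nlinarith, h2⟩, by linarith, by linarith⟩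

/-- The argument of `Φ` in (as15) (Seregin–Šverák 2009, arXiv p. 10) = the functional `𝒜₂` of
Seregin–Zajaczkowski 2007, Prop. 4.1 (arXiv p. 5), at unit scale:
`𝒜₂(u, p) = sup_{-2²<s<0} ∫_{𝒫²₁(0)} |u|² dy + ∫_{Q²₁(0)} |∇u|² + ∫_{Q²₁(0)} |u|³
  + ∫_{Q²₁(0)} |p|^{3/2}`, in `ℝ≥0∞`, the supremum rendered as an essential supremum in time,
`|∇u|²` the squared Frobenius norm of a (weak) spatial gradient `G` standing for `∇u`.
[cite: SereginSverak2009, proof of Prop. 3.7, (as15) (arXiv p. 10)] -/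
def szEnergy (u : ℝ → ℝ³ → ℝ³) (p : ℝ → ℝ³ → ℝ) (G : ℝ → ℝ³ → ℝ³ →L[ℝ] ℝ³) : ℝ≥0∞ :=
  essSup (fun s : ℝ => ∫⁻ y in outerShellSpace 1 0, ‖u s y‖ₑ ^ 2)
      (volume.restrict (Ioo (-2 ^ 2) 0)) +
    (∫⁻ z in outerShell 1 0, ENNReal.ofReal (frobeniusNormSq (G z.1 z.2))) +
    (∫⁻ z in outerShell 1 0, ‖u z.1 z.2‖ₑ ^ (3 : ℕ)) +
    ∫⁻ z in outerShell 1 0, ‖p z.1 z.2‖ₑ ^ (3 / 2 : ℝ)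

/-- **The conditions of Theorem 3.1 on the cylinder `Q(0, R)`** (Seregin–Šverák 2009, §3 and
Thm. 3.1, arXiv p. 9, transported from `Q = Q(0,1)` to `Q(0, R) = 𝒞(0,R) × ]-R², 0[`): `(u, p)`
solves the Navier–Stokes system (`ν = 1`, no force) in the sense of distributions in `Q(0, R)`,
`u ∈ L³(Q(0,R))`, `p ∈ L^{3/2}(Q(0,R))`, every slice `u t`, `-R² < t < 0`, is axisymmetric
(pointwise, as in `IsAxisymmetricLocalSolution`), and the Type I bound (r3) holds in the junk-free
form `√(-t) ‖u(t,x)‖ ≤ C` a.e. on `Q(0, R)`. At `R = 1` this is exactly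
`IsAxisymmetricLocalSolution u p ∧ IsTypeIOnCyl u` (`isTypeIAxisymmetricSolutionOn_one_iff`); the
class is invariant under the scaling of the proof of Prop. 3.7
(`IsTypeIAxisymmetricSolutionOn.rescale`).
[cite: SereginSverak2009, Thm. 3.1 and §3 (arXiv p. 9)] -/
structure IsTypeIAxisymmetricSolutionOn (R : ℝ) (u : ℝ → ℝ³ → ℝ³) (p : ℝ → ℝ³ → ℝ) : Prop where
  /-- Navier–Stokes in the sense of distributions in `Q(0, R)`. -/
  distributional : IsDistributionalNSSolutionOn (parCylOpens 0 R) 1 0 u p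
  /-- `u ∈ L³(Q(0, R))`. -/
  velocity_L3 : ∫⁻ z in parCyl 0 R, ‖u z.1 z.2‖ₑ ^ (3 : ℕ) < ∞
  /-- `p ∈ L^{3/2}(Q(0, R))`. -/
  pressure_L32 : ∫⁻ z in parCyl 0 R, ‖p z.1 z.2‖ₑ ^ (3 / 2 : ℝ) < ∞
  /-- every slice is axisymmetric about the `x₃`-axis. -/
  axisymmetric : ∀ t ∈ Ioo (-R ^ 2) 0, IsAxisymmetric (u t)
  /-- the Type I bound (r3), `√(-t) ‖u‖ ≤ C` a.e. on `Q(0, R)`. -/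
  typeI : ∃ C : ℝ, ∀ᵐ z ∂(volume.restrict (parCyl 0 R)), Real.sqrt (-z.1) * ‖u z.1 z.2‖ ≤ C

/-- At `R = 1` the class is the conjunction of the hypotheses of Thm. 3.1 as rendered in the
parent file. [cite: SereginSverak2009, Thm. 3.1] -/
theorem isTypeIAxisymmetricSolutionOn_one_iff {u : ℝ → ℝ³ → ℝ³} {p : ℝ → ℝ³ → ℝ} :
    IsTypeIAxisymmetricSolutionOn 1 u p ↔ IsAxisymmetricLocalSolution u p ∧ IsTypeIOnCyl u := by
  constructor
  · intro h
    exact ⟨⟨h.distributional, h.velocity_L3, h.pressure_L32,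
      fun t ht => h.axisymmetric t (by simpa using ht)⟩, h.typeI⟩
  · rintro ⟨hsol, hI⟩
    exact ⟨hsol.distributional, hsol.velocity_L3, hsol.pressure_L32,
      fun t ht => hsol.axisymmetric t (by simpa using ht), hI⟩

/-- **Seregin–Šverák 2009, proof of Proposition 3.7, (as15)** (arXiv:0804.1803, p. 10: "As it was
shown in [S11], there exists a continuous nondecreasing function `Φ : ℝ₊ → ℝ₊` such that
`sup_{(y,s) ∈ Q¹₁(0)} |u(y,s)| + |∇u(y,s)| ≤ Φ( sup_{-2²<s<0} ∫_{𝒫²₁(0)} |u|² dy + ∫_{Q²₁(0)} |∇u|²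
+ ∫_{Q²₁(0)} |u|³ + ∫_{Q²₁(0)} |p|^{3/2} )`", asserted for the rescalings
`u(y,s) = r₀v(r₀y + b₀e₃, r₀²s)`, `p = r₀²q` of pairs `(v, q)` under the conditions of Thm. 3.1;
the inequality is Seregin–Zajaczkowski 2007, Prop. 4.1, (4.1) (arXiv:math/0702720, p. 5), printed
there for sufficiently smooth axially symmetric solutions in `Q̃ = 𝒞(1/4,3;2) × ]-2²,0[ = Q²₁(0)`
with `Φ` non-decreasing and not depending on the solution). Rendered (module docstring): for the
class `IsTypeIAxisymmetricSolutionOn 3` (Type I axially symmetric distributional solutions,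
`u ∈ L³`, `p ∈ L^{3/2}`, on `Q(0,3) ⊇ Q²₁(0)` — the conditions of Thm. 3.1 after the scaling),
SOME non-decreasing `Φ : ℝ≥0 → ℝ≥0` chosen before the solution, continuity and the gradient half
of the left-hand side dropped, `sup` as an a.e. bound: `‖u‖ ≤ Φ K` a.e. on `Q¹₁(0)`
(`innerShell 1 0`) whenever `𝒜₂(u, p) ≤ K` (`szEnergy`, `|∇u|²` through any weak spatial gradient
`G` of `u` on `Q(0,3)`).
[cite: SereginSverak2009, proof of Prop. 3.7, (as15) (arXiv p. 10)] -/
def UnitScaleOffAxisBound : Prop :=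
  ∃ Φ : ℝ≥0 → ℝ≥0, Monotone Φ ∧
    ∀ (u : ℝ → ℝ³ → ℝ³) (p : ℝ → ℝ³ → ℝ), IsTypeIAxisymmetricSolutionOn 3 u p →
      ∀ G : ℝ → ℝ³ → ℝ³ →L[ℝ] ℝ³, HasWeakSpatialGradientOn (parCylOpens 0 3) u G →
        ∀ K : ℝ≥0, szEnergy u p G ≤ K →
          ∀ᵐ z ∂(volume.restrict (innerShell 1 0)), ‖u z.1 z.2‖ ≤ Φ K

/-! ### `𝒜₂ ≤ c (A + E + C + D)(0, 3)` -/

/-- `X ≤ 9 · (3⁻¹ X)` in `ℝ≥0∞`. [folklore] -/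
theorem le_nine_mul_inv_three_mul (X : ℝ≥0∞) : X ≤ 9 * ((ENNReal.ofReal 3)⁻¹ * X) := by
  rw [ENNReal.ofReal_ofNat, ← mul_assoc]
  have h3 : (3 : ℝ≥0∞) * 3⁻¹ = 1 := ENNReal.mul_inv_cancel (by norm_num) (by simp)
  have h : (1 : ℝ≥0∞) ≤ 9 * 3⁻¹ :=
    calc (1 : ℝ≥0∞) = 3 * 3⁻¹ := h3.symm
      _ ≤ 9 * 3⁻¹ := mul_le_mul_left (by norm_num) _
  calc X = 1 * X := (one_mul X).symm
    _ ≤ 9 * 3⁻¹ * X := mul_le_mul_left h X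

/-- `X ≤ 9 · ((3²)⁻¹ X)` in `ℝ≥0∞`. [folklore] -/
theorem le_nine_mul_inv_sq_three_mul (X : ℝ≥0∞) : X ≤ 9 * ((ENNReal.ofReal 3 ^ 2)⁻¹ * X) := by
  rw [ENNReal.ofReal_ofNat, ← mul_assoc]
  have h9 : (3 : ℝ≥0∞) ^ 2 = 9 := by norm_num
  rw [h9, ENNReal.mul_inv_cancel (by norm_num) (by simp), one_mul]

/-- **The constant `c` of the display after (as15)**: `𝒜₂(u, p) ≤ 9 (A + E + C + D)(0, 3; u, p)`,
since `𝒫²₁(0) ⊆ 𝒞(0,3)`, `]-2², 0[ ⊆ ]-3², 0[`, `Q²₁(0) ⊆ Q(0,3)` and the functionals at radius `3`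
carry the factors `3⁻¹, 3⁻¹, 3⁻², 3⁻²` (Seregin–Šverák 2009, arXiv p. 10; Seregin–Zajaczkowski 2007,
§5, arXiv p. 8: `Ã_{2R} ≤ c(A + E + C + D)(e^b, 3R)`).
[cite: SereginSverak2009, proof of Prop. 3.7, display after (as15) (arXiv p. 10)] -/
theorem szEnergy_le (u : ℝ → ℝ³ → ℝ³) (p : ℝ → ℝ³ → ℝ) (G : ℝ → ℝ³ → ℝ³ →L[ℝ] ℝ³) :
    szEnergy u p G ≤
      9 * (energyA 0 3 u + dissipationE 0 3 G + cubicC 0 3 u + pressureD 0 3 p) := by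
  have hA : essSup (fun s : ℝ => ∫⁻ y in outerShellSpace 1 0, ‖u s y‖ₑ ^ 2)
      (volume.restrict (Ioo (-2 ^ 2) 0)) ≤ 9 * energyA 0 3 u := by
    unfold energyA
    rw [← ENNReal.essSup_const_mul]
    simp only [Prod.fst_zero, Prod.snd_zero, zero_sub]
    have hmeas : volume.restrict (Ioo (-2 ^ 2 : ℝ) 0) ≤ volume.restrict (Ioo (-3 ^ 2 : ℝ) 0) :=
      Measure.restrict_mono_set _ (Ioo_subset_Ioo (by norm_num) le_rfl)
    refine (essSup_mono_measure (Measure.absolutelyContinuous_of_le hmeas)).trans ?_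
    refine essSup_mono_ae (Eventually.of_forall fun s => ?_)
    exact (lintegral_mono_set outerShellSpace_one_subset).trans (le_nine_mul_inv_three_mul _)
  have hE : ∫⁻ z in outerShell 1 0, ENNReal.ofReal (frobeniusNormSq (G z.1 z.2)) ≤
      9 * dissipationE 0 3 G :=
    (lintegral_mono_set outerShell_one_subset).trans (le_nine_mul_inv_three_mul _)
  have hC : ∫⁻ z in outerShell 1 0, ‖u z.1 z.2‖ₑ ^ (3 : ℕ) ≤ 9 * cubicC 0 3 u :=
    (lintegral_mono_set outerShell_one_subset).trans (le_nine_mul_inv_sq_three_mul _)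
  have hD : ∫⁻ z in outerShell 1 0, ‖p z.1 z.2‖ₑ ^ (3 / 2 : ℝ) ≤ 9 * pressureD 0 3 p :=
    (lintegral_mono_set outerShell_one_subset).trans (le_nine_mul_inv_sq_three_mul _)
  unfold szEnergy
  calc _ ≤ 9 * energyA 0 3 u + 9 * dissipationE 0 3 G + 9 * cubicC 0 3 u +
        9 * pressureD 0 3 p := add_le_add (add_le_add (add_le_add hA hE) hC) hD
    _ = 9 * (energyA 0 3 u + dissipationE 0 3 G + cubicC 0 3 u + pressureD 0 3 p) := by ring

/-! ### The scaling of the proof of Proposition 3.7 -/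

/-- `‖x‖ₑ ^ n = ofReal (x ^ n)` for `x ≥ 0`. [folklore] -/
theorem enorm_pow_eq_ofReal {x : ℝ} (hx : 0 ≤ x) (n : ℕ) : ‖x‖ₑ ^ n = ENNReal.ofReal (x ^ n) := by
  rw [Real.enorm_eq_ofReal hx, ENNReal.ofReal_pow hx]

/-- `(ofReal x ^ n)⁻¹ = ofReal ((x ^ n)⁻¹)` for `x > 0`. [folklore] -/
theorem ofReal_pow_inv {x : ℝ} (hx : 0 < x) (n : ℕ) :
    (ENNReal.ofReal x ^ n)⁻¹ = ENNReal.ofReal ((x ^ n)⁻¹) := by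
  rw [← ENNReal.ofReal_pow hx.le, ENNReal.ofReal_inv_of_pos (pow_pos hx n)]

/-- **The conditions of Theorem 3.1 are invariant under the scaling of the proof of Prop. 3.7.**
If `(v, q)` satisfies them on `Q = Q(0,1)` and `Q(z_b, λR) ⊆ Q` (`0 < λ`, `λR ≤ 1`,
`|b| + λR ≤ 1`), then `u(s, y) = λ v(λ² s, b e₃ + λ y)`, `p = λ² q ∘ Φ` satisfy them on
`Q(0, R) = Φ⁻¹(Q(z_b, λR))`, `Φ(s,y) = (λ²s, b e₃ + λ y)`: the Navier–Stokes system is covariant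
(accepted `IsDistributionalNSSolutionOn.stRescale`, restricted to `Q(0,R)`), `∫ |u|³` and
`∫ |p|^{3/2}` scale by `λ³ · λ⁻⁵` (`setLIntegral_enorm_pow_stRescale`), axial symmetry commutes
with `Φ` (`isAxisymmetric_rescale`), and `√(-s) |u(s,y)| = √(-t) |v(x,t)|`
(Seregin–Šverák 2009, §3, p. 9: "the Navier–Stokes equations are invariant with respect to the
scaling `u(x,t) = λv(λx, λ²t)`, `p(x,t) = λ²q(λx, λ²t)`"; proof of Prop. 3.7, p. 10).
[cite: SereginSverak2009, §3 (scaling, arXiv p. 9) and proof of Prop. 3.7 (arXiv p. 10)] -/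
theorem IsTypeIAxisymmetricSolutionOn.rescale {v : ℝ → ℝ³ → ℝ³} {q : ℝ → ℝ³ → ℝ}
    (h : IsTypeIAxisymmetricSolutionOn 1 v q) {lam R : ℝ} (hlam : 0 < lam) (hR : 0 < R)
    (hR1 : lam * R ≤ 1) (b : ℝ) (hb : |b| + lam * R ≤ 1) :
    IsTypeIAxisymmetricSolutionOn R (lam • stPull (lam ^ 2) lam 0 (b • eZ) v)
      (lam ^ 2 • stPull (lam ^ 2) lam 0 (b • eZ) q) := by
  have hl2 : 0 < lam ^ 2 := by positivity
  have hlR : 0 ≤ lam * R := by positivity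
  -- `Q(0, R) = Φ⁻¹(Q(z_b, λR)) ⊆ Φ⁻¹(Q)`
  have hpre : stAffine (lam ^ 2) lam 0 (b • eZ) ⁻¹' parCyl ((0 : ℝ), b • eZ) (lam * R) =
      parCyl 0 R := preimage_parCyl_axisAffine hlam b R
  have hsubQ : parCyl ((0 : ℝ), b • eZ) (lam * R) ⊆ parCyl 0 1 :=
    parCyl_axis_subset_unit hlR hR1 hb
  have hsub : parCyl (0 : ℝ × ℝ³) R ⊆ stAffine (lam ^ 2) lam 0 (b • eZ) ⁻¹' parCyl 0 1 := by
    rw [← hpre]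
    exact preimage_mono hsubQ
  have hle : parCylOpens (0 : ℝ × ℝ³) R ≤ stPreimage (lam ^ 2) lam 0 (b • eZ) (parCylOpens 0 1) :=
    fun z hz => hsub hz
  have hfin : ENNReal.ofReal (lam ^ 2 * lam ^ finrank ℝ ℝ³)⁻¹ ≠ ∞ := ENNReal.ofReal_ne_top
  refine ⟨?_, ?_, ?_, ?_, ?_⟩
  · -- covariance of the Navier–Stokes system, then restriction to `Q(0, R)`
    have key := h.distributional.stRescale hlam hlam (sq lam) 0 (b • eZ)
    have hν : lam * 1 / lam = 1 := by field_simp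
    have hf : ((lam ^ 2 * lam) • stPull (lam ^ 2) lam 0 (b • eZ) (0 : ℝ → ℝ³ → ℝ³)) = 0 := by
      funext s y
      simp [stPull]
    rw [hν, hf] at key
    exact key.of_le hle
  · -- `∫_{Q(0,R)} |u|³ = λ³ λ⁻⁵ ∫_{Q(z_b, λR)} |v|³ < ∞`
    rw [← hpre, setLIntegral_enorm_pow_stRescale hl2 hlam 0 (b • eZ) lam v _ 3]
    refine ENNReal.mul_lt_top (ENNReal.mul_lt_top ?_ hfin.lt_top) ?_
    · exact (ENNReal.pow_lt_top enorm_lt_top)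
    · exact (lintegral_mono_set hsubQ).trans_lt h.velocity_L3
  · -- `∫_{Q(0,R)} |p|^{3/2} = λ³ λ⁻⁵ ∫_{Q(z_b, λR)} |q|^{3/2} < ∞`
    rw [← hpre, setLIntegral_enorm_rpow_stRescale hl2 hlam 0 (b • eZ) (lam ^ 2) q _
      (by norm_num : (0 : ℝ) ≤ 3 / 2)]
    refine ENNReal.mul_lt_top (ENNReal.mul_lt_top ?_ hfin.lt_top) ?_
    · exact ENNReal.rpow_lt_top_of_nonneg (by norm_num) enorm_ne_top
    · exact (lintegral_mono_set hsubQ).trans_lt h.pressure_L32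
  · -- axial symmetry of the slices
    intro s hs
    have ht : 0 + lam ^ 2 * s ∈ Ioo (-1 ^ 2 : ℝ) 0 := by
      have h1 : (lam * R) ^ 2 ≤ 1 := by nlinarith
      refine ⟨?_, by nlinarith [hs.2]⟩
      nlinarith [mul_lt_mul_of_pos_left hs.1 hl2]
    exact isAxisymmetric_rescale (h.axisymmetric _ ht) lam b lam
  · -- the Type I bound is scale invariant
    obtain ⟨C, hC⟩ := h.typeI
    refine ⟨C, ?_⟩
    have h1 := ae_restrict_of_ae_restrict_of_subset hsub
      (ae_restrict_preimage_stAffine hl2 hlam 0 (b • eZ) hC)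
    filter_upwards [h1] with z hz
    have hsq : Real.sqrt (-(0 + lam ^ 2 * z.1)) = lam * Real.sqrt (-z.1) := by
      rw [zero_add, show -(lam ^ 2 * z.1) = lam ^ 2 * -z.1 by ring, Real.sqrt_mul hl2.le,
        Real.sqrt_sq hlam.le]
    rw [smul_stPull_apply, norm_smul, Real.norm_eq_abs, abs_of_pos hlam]
    calc Real.sqrt (-z.1) * (lam * ‖v (0 + lam ^ 2 * z.1) (b • eZ + lam • z.2)‖)
        = Real.sqrt (-(0 + lam ^ 2 * z.1)) * ‖v (0 + lam ^ 2 * z.1) (b • eZ + lam • z.2)‖ := by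
          rw [hsq]; ring
      _ ≤ C := hz

/-- **Scaling of `C`**: `C(0, ρ; u) = C(z_b, λρ; v)` for `u = λ v ∘ Φ`
(`∫ |u|³ dz' = λ³ λ⁻⁵ ∫ |v|³ dz` and `ρ⁻² λ⁻² = (λρ)⁻²`; Seregin–Šverák 2009, §3: "scale-invariant
functionals").
[cite: SereginSverak2009, §3 (arXiv p. 9) and proof of Prop. 3.7 (arXiv p. 10)] -/
theorem cubicC_rescale {lam : ℝ} (hlam : 0 < lam) (b : ℝ) {ρ : ℝ} (hρ : 0 < ρ)
    (v : ℝ → ℝ³ → ℝ³) :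
    cubicC 0 ρ (lam • stPull (lam ^ 2) lam 0 (b • eZ) v) =
      cubicC ((0 : ℝ), b • eZ) (lam * ρ) v := by
  have hl2 : 0 < lam ^ 2 := by positivity
  unfold cubicC
  rw [← preimage_parCyl_axisAffine hlam b ρ, setLIntegral_enorm_pow_stRescale hl2 hlam 0 (b • eZ)
    lam v _ 3, finrank_euclideanSpace_fin, ← mul_assoc]
  congr 1
  rw [ofReal_pow_inv hρ, ofReal_pow_inv (mul_pos hlam hρ), enorm_pow_eq_ofReal hlam.le,
    ← ENNReal.ofReal_mul (by positivity), ← ENNReal.ofReal_mul (by positivity)]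
  congr 1
  field_simp

/-- **Scaling of `D`**: `D(0, ρ; p) = D(z_b, λρ; q)` for `p = λ² q ∘ Φ`
(`∫ |p|^{3/2} dz' = λ³ λ⁻⁵ ∫ |q|^{3/2} dz`).
[cite: SereginSverak2009, §3 (arXiv p. 9) and proof of Prop. 3.7 (arXiv p. 10)] -/
theorem pressureD_rescale {lam : ℝ} (hlam : 0 < lam) (b : ℝ) {ρ : ℝ} (hρ : 0 < ρ)
    (q : ℝ → ℝ³ → ℝ) :
    pressureD 0 ρ (lam ^ 2 • stPull (lam ^ 2) lam 0 (b • eZ) q) =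
      pressureD ((0 : ℝ), b • eZ) (lam * ρ) q := by
  have hl2 : 0 < lam ^ 2 := by positivity
  have h32 : (lam ^ 2) ^ (3 / 2 : ℝ) = lam ^ 3 := by
    rw [← Real.rpow_natCast lam 2, ← Real.rpow_mul hlam.le]
    norm_num
  unfold pressureD
  rw [← preimage_parCyl_axisAffine hlam b ρ, setLIntegral_enorm_rpow_stRescale hl2 hlam 0 (b • eZ)
    (lam ^ 2) q _ (by norm_num : (0 : ℝ) ≤ 3 / 2), finrank_euclideanSpace_fin, ← mul_assoc]
  congr 1
  rw [ofReal_pow_inv hρ, ofReal_pow_inv (mul_pos hlam hρ), Real.enorm_eq_ofReal hl2.le,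
    ENNReal.ofReal_rpow_of_nonneg hl2.le (by norm_num), h32,
    ← ENNReal.ofReal_mul (by positivity), ← ENNReal.ofReal_mul (by positivity)]
  congr 1
  field_simp

/-- **Scaling of `E`**: `E(0, ρ; λ² G ∘ Φ) = E(z_b, λρ; G)` (`∫ |λ² G ∘ Φ|² dz' = λ⁴ λ⁻⁵ ∫ |G|² dz`;
`λ² G ∘ Φ` is the weak spatial gradient of `u = λ v ∘ Φ`, `HasWeakSpatialGradientOn.stRescale`).
[cite: SereginSverak2009, §3 (arXiv p. 9) and proof of Prop. 3.7 (arXiv p. 10)] -/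
theorem dissipationE_rescale {lam : ℝ} (hlam : 0 < lam) (b : ℝ) {ρ : ℝ} (hρ : 0 < ρ)
    (G : ℝ → ℝ³ → ℝ³ →L[ℝ] ℝ³) :
    dissipationE 0 ρ ((lam * lam) • stPull (lam ^ 2) lam 0 (b • eZ) G) =
      dissipationE ((0 : ℝ), b • eZ) (lam * ρ) G := by
  have hl2 : 0 < lam ^ 2 := by positivity
  unfold dissipationE
  rw [← preimage_parCyl_axisAffine hlam b ρ, setLIntegral_frobeniusNormSq_stRescale hl2 hlam 0
    (b • eZ) (lam * lam) G, finrank_euclideanSpace_fin, ← mul_assoc]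
  congr 1
  rw [← ENNReal.ofReal_inv_of_pos hρ, ← ENNReal.ofReal_inv_of_pos (mul_pos hlam hρ),
    ← ENNReal.ofReal_mul (by positivity), ← ENNReal.ofReal_mul (by positivity)]
  congr 1
  field_simp

/-- **Scaling of `A`**: `A(0, ρ; u) ≤ A(z_b, λρ; v)` for `u = λ v ∘ Φ` (in fact equality): for a.e.
`t ∈ ]-(λρ)², 0[`, `(λρ)⁻¹ ∫_{𝒞(b e₃, λρ)} |v(t)|² ≤ A(z_b, λρ; v)`, and along `t = λ² s` this is
`ρ⁻¹ ∫_{𝒞(0,ρ)} |u(s)|² ≤ A(z_b, λρ; v)` for a.e. `s ∈ ]-ρ², 0[` (`dy = λ⁻³ dx`).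
[cite: SereginSverak2009, §3 (arXiv p. 9) and proof of Prop. 3.7 (arXiv p. 10)] -/
theorem energyA_rescale_le {lam : ℝ} (hlam : 0 < lam) (b : ℝ) {ρ : ℝ} (hρ : 0 < ρ)
    (v : ℝ → ℝ³ → ℝ³) :
    energyA 0 ρ (lam • stPull (lam ^ 2) lam 0 (b • eZ) v) ≤
      energyA ((0 : ℝ), b • eZ) (lam * ρ) v := by
  have hl2 : 0 < lam ^ 2 := by positivity
  set M := energyA ((0 : ℝ), b • eZ) (lam * ρ) v with hM
  unfold energyA at hM ⊢
  simp only [Prod.fst_zero, Prod.snd_zero, zero_sub]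
  -- the defining a.e. bound for `v`, transported along `t = λ² s`
  have h1 : ∀ᵐ t ∂(volume.restrict (Ioo (0 + lam ^ 2 * -ρ ^ 2) (0 + lam ^ 2 * 0))),
      (ENNReal.ofReal (lam * ρ))⁻¹ * ∫⁻ x in spaceCyl (b • eZ) (lam * ρ), ‖v t x‖ₑ ^ 2 ≤ M := by
    have e1 : (0 : ℝ) + lam ^ 2 * -ρ ^ 2 = 0 - (lam * ρ) ^ 2 := by ring
    have e2 : (0 : ℝ) + lam ^ 2 * 0 = 0 := by ring
    rw [e1, e2, hM]
    exact ENNReal.ae_le_essSup _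
  have h2 := ae_restrict_Ioo_comp_time_affine hl2 0 (-ρ ^ 2) 0 h1
  refine essSup_le_of_ae_le M ?_
  filter_upwards [h2] with s hs
  -- `ρ⁻¹ ∫_{𝒞(0,ρ)} |u(s)|² = (λρ)⁻¹ ∫_{𝒞(b e₃, λρ)} |v(λ² s)|²`
  have key : (ENNReal.ofReal ρ)⁻¹ * ∫⁻ y in spaceCyl (0 : ℝ³) ρ,
      ‖(lam • stPull (lam ^ 2) lam 0 (b • eZ) v) s y‖ₑ ^ 2 =
      (ENNReal.ofReal (lam * ρ))⁻¹ *
        ∫⁻ x in spaceCyl (b • eZ) (lam * ρ), ‖v (0 + lam ^ 2 * s) x‖ₑ ^ 2 := by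
    have e : ∀ y, ‖(lam • stPull (lam ^ 2) lam 0 (b • eZ) v) s y‖ₑ ^ 2 =
        ‖lam‖ₑ ^ 2 * ‖v (0 + lam ^ 2 * s) (b • eZ + lam • y)‖ₑ ^ 2 := by
      intro y
      rw [smul_stPull_apply, enorm_smul, mul_pow]
    simp_rw [e]
    rw [lintegral_const_mul' _ _ (ENNReal.pow_ne_top enorm_ne_top),
      ← preimage_spaceCyl_axisAffine hlam b ρ,
      setLIntegral_preimage_comp_space_affine hlam (b • eZ)
        (fun x => ‖v (0 + lam ^ 2 * s) x‖ₑ ^ 2) (spaceCyl (b • eZ) (lam * ρ)),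
      finrank_euclideanSpace_fin, ← mul_assoc, ← mul_assoc]
    congr 1
    rw [← ENNReal.ofReal_inv_of_pos hρ, ← ENNReal.ofReal_inv_of_pos (mul_pos hlam hρ),
      enorm_pow_eq_ofReal hlam.le, ← ENNReal.ofReal_mul (by positivity),
      ← ENNReal.ofReal_mul (by positivity)]
    congr 1
    field_simp
  rw [key]
  exact hs

/-! ### Proved: the inverse scaling in (as15) -/

/-- **Seregin–Šverák 2009, proof of Proposition 3.7: "After making inverse scaling in (as15), we
find `sup_{z ∈ Q¹_{r₀}(b₀)} r₀|v| + r₀²|∇v| ≤ Φ(cA(z_{b₀},3r₀;v) + cE(z_{b₀},3r₀;v) +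
cC(z_{b₀},3r₀;v) + cD(z_{b₀},3r₀;q))`"** (arXiv p. 10), proved from (as15)
(`UnitScaleOffAxisBound`): given `(v, q)` under the conditions of Thm. 3.1, `0 < r₀ < 1/8`,
`|b₀| < 1/8`, a weak spatial gradient `G` of `v` on `Q` and `(A+E+C+D)(z_{b₀}, 3r₀) ≤ K`, the
rescaled pair `u = r₀ v ∘ Φ`, `p = r₀² q ∘ Φ`, `Φ(s,y) = (r₀²s, b₀e₃ + r₀y)`, lies in the class of
(as15) on `Q(0,3) = Φ⁻¹(Q(z_{b₀}, 3r₀))` (`IsTypeIAxisymmetricSolutionOn.rescale`, as `3r₀ ≤ 1`,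
`|b₀| + 3r₀ ≤ 1`), with weak gradient `r₀² G ∘ Φ`, and
`𝒜₂(u, p) ≤ 9 (A+E+C+D)(0, 3; u, p) ≤ 9 (A+E+C+D)(z_{b₀}, 3r₀; v, q) ≤ 9K` (`szEnergy_le` and the
scaling identities); (as15) bounds `|u| ≤ Φ(9K)` a.e. on `Q¹₁(0) = Φ⁻¹(Q¹_{r₀}(b₀))`, i.e.
`r₀|v| ≤ Φ(9K)` a.e. on `Q¹_{r₀}(b₀)`. The `Φ` of `OffAxisBound` is `K ↦ Φ(9K)`.
[cite: SereginSverak2009, proof of Prop. 3.7, display after (as15) (arXiv p. 10)] -/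
theorem offAxisBound_of_unitScaleOffAxisBound (h : UnitScaleOffAxisBound) : OffAxisBound := by
  obtain ⟨Φ, hΦm, hΦ⟩ := h
  refine ⟨fun K => Φ (9 * K), fun a b hab => hΦm (mul_le_mul_right hab 9), ?_⟩
  intro v q hsol hI G hG r₀ hr₀ b₀ hb₀ K hK
  obtain ⟨hr0, hr8⟩ := hr₀
  have hl2 : 0 < r₀ ^ 2 := by positivity
  have h1 : IsTypeIAxisymmetricSolutionOn 1 v q :=
    isTypeIAxisymmetricSolutionOn_one_iff.2 ⟨hsol, hI⟩
  have hR1 : r₀ * 3 ≤ 1 := by linarith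
  have hb : |b₀| + r₀ * 3 ≤ 1 := by linarith [hb₀]
  -- the rescaled pair and its weak spatial gradient on `Q(0, 3)`
  set u := r₀ • stPull (r₀ ^ 2) r₀ 0 (b₀ • eZ) v with hu
  set p := r₀ ^ 2 • stPull (r₀ ^ 2) r₀ 0 (b₀ • eZ) q with hp
  set G' := (r₀ * r₀) • stPull (r₀ ^ 2) r₀ 0 (b₀ • eZ) G with hG'
  have hcls : IsTypeIAxisymmetricSolutionOn 3 u p := h1.rescale hr0 (by norm_num) hR1 b₀ hb
  have hpre : stAffine (r₀ ^ 2) r₀ 0 (b₀ • eZ) ⁻¹' parCyl ((0 : ℝ), b₀ • eZ) (r₀ * 3) =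
      parCyl 0 3 := preimage_parCyl_axisAffine hr0 b₀ 3
  have hsub : parCyl (0 : ℝ × ℝ³) 3 ⊆ stAffine (r₀ ^ 2) r₀ 0 (b₀ • eZ) ⁻¹' parCyl 0 1 := by
    rw [← hpre]
    exact preimage_mono (parCyl_axis_subset_unit (by positivity) hR1 hb)
  have hle : parCylOpens (0 : ℝ × ℝ³) 3 ≤ stPreimage (r₀ ^ 2) r₀ 0 (b₀ • eZ) (parCylOpens 0 1) :=
    fun z hz => hsub hz
  have hG'w : HasWeakSpatialGradientOn (parCylOpens 0 3) u G' :=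
    (hG.stRescale r₀ hl2 hr0 0 (b₀ • eZ)).mono hle
  -- `𝒜₂(u, p) ≤ 9 (A+E+C+D)(0,3; u, p) ≤ 9 (A+E+C+D)(z_{b₀}, 3r₀; v, q) ≤ 9 K`
  have hfun : energyA 0 3 u + dissipationE 0 3 G' + cubicC 0 3 u + pressureD 0 3 p ≤
      energyA ((0 : ℝ), b₀ • eZ) (3 * r₀) v + dissipationE ((0 : ℝ), b₀ • eZ) (3 * r₀) G +
        cubicC ((0 : ℝ), b₀ • eZ) (3 * r₀) v + pressureD ((0 : ℝ), b₀ • eZ) (3 * r₀) q := by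
    rw [mul_comm 3 r₀, hu, hp, hG', ← cubicC_rescale hr0 b₀ (by norm_num) v,
      ← pressureD_rescale hr0 b₀ (by norm_num) q, ← dissipationE_rescale hr0 b₀ (by norm_num) G]
    gcongr
    exact energyA_rescale_le hr0 b₀ (by norm_num) v
  have hK' : szEnergy u p G' ≤ ((9 * K : ℝ≥0) : ℝ≥0∞) := by
    rw [ENNReal.coe_mul, ENNReal.coe_ofNat]
    exact (szEnergy_le u p G').trans (mul_le_mul_right (hfun.trans hK) 9)
  -- (as15) on `Q¹₁(0) = Φ⁻¹(Q¹_{r₀}(b₀))`, transported back along `Φ`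
  have hae := hΦ u p hcls G' hG'w (9 * K) hK'
  have hshell : stAffine (r₀ ^ 2) r₀ 0 (b₀ • eZ) ⁻¹' innerShell r₀ b₀ = innerShell 1 0 := by
    simpa using preimage_innerShell_axisAffine hr0 b₀ 1
  rw [← hshell] at hae
  refine ae_restrict_of_ae_restrict_preimage_stAffine hl2 hr0 0 (b₀ • eZ)
    (P := fun z => r₀ * ‖v z.1 z.2‖ ≤ ((Φ (9 * K) : ℝ≥0) : ℝ)) ?_
  filter_upwards [hae] with z hz
  rw [hu, smul_stPull_apply, norm_smul, Real.norm_eq_abs, abs_of_pos hr0] at hz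
  exact hz

/-- **Seregin–Šverák 2009, Proposition 3.7 from Lemma 3.5 and (as15)**: the printed proof in
full — Lemma 3.5 (`ScaledEnergyBound`), the bound (as15) quoted from [S11]
(`UnitScaleOffAxisBound`), the inverse scaling (`offAxisBound_of_unitScaleOffAxisBound`) and the
covering argument (`axisDecayBound_of_offAxisBound`) give `|x'| |v| ≤ C₁` a.e. on `Q(1/8)`.
[cite: SereginSverak2009, Prop. 3.7 and its proof (arXiv p. 10)] -/
theorem axisDecayBound_of_unitScaleOffAxisBound (h35 : ScaledEnergyBound)
    (h15 : UnitScaleOffAxisBound) : AxisDecayBound :=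
  axisDecayBound_of_offAxisBound h35 (offAxisBound_of_unitScaleOffAxisBound h15)

end SereginSverak2009

end Literature.Analysis.FluidPDE
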